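import Literature.AlgebraicGeometry.Frobenioids.BaseCategoryTheoreticity
import Literature.AlgebraicGeometry.Frobenioids.BaseCategoryTheoreticityExamples
import Literature.AlgebraicGeometry.Frobenioids.FSMFFType2024WalkingArrow
import Literature.AlgebraicGeometry.Frobenioids.PerfectionSquareNotOneUnique
import Mathlib.Algebra.Group.PUnit
import Mathlib.CategoryTheory.Category.Preorder
import Mathlib.CategoryTheory.Thin
import Mathlib.Tactic.FinCases
import HarnessLib

/-!
# Frobenioids I, §3: the schemata `HypB`, `OneUniqueSquare`, `PreservesDegFr`, `Prop311ii` of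
# `BaseCategoryTheoreticity.lean` have REFUTABLE universal closures (FACT-LIST F-0893 / F-0894 / F-0895 / F-0897)

Mochizuki, *The geometry of Frobenioids I: the general theory*, Kyushu J. Math. **62** (2008) 293–400,
kurims text, Thm. 3.4 pp. 62–63, Ex. 3.5 pp. 69–70, Prop. 3.11 p. 73 [cite: MochizukiFrdI2008, Thm. 3.4 p.62].

Negative knowledge recorded next to `BaseCategoryTheoreticity.lean` (abc-iut-L1-t3), PROOF-ONLY (no definitions,
no instances; the witnesses are built inside the proofs), abc-iut cell seat abc-iut-f-017 (F fact-proving wave).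
The four rows are PARAMETRISED predicates over the bare operations interface `S_i : PreFrobenioidData C_i D_i`
(Def. 1.1 (iv): `Base`, `Div`, `deg_Fr` and their composition laws — NOT the Frobenioid axioms of Def. 1.3) and an
arbitrary equivalence `Ψ : C₁ ≌ C₂`; none of them is a closed sentence, and none holds for all values of its binders:

* `PreFrobenioidData.HypB S₁ S₂ Ψ` (F-0893) is HYPOTHESIS (b) of Thm. 3.4 (iii)–(v) ("if `C₁, C₂` are of group-like
  type, then `Ψ` and some quasi-inverse preserve base-isomorphisms"), a binder of every consumer, never a claim of
  the paper (Examples 3.6–3.9, pp. 70–72, are print's own Frobenioids violating it). Kernel witness here: the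
  GROUP-LIKE READING of the one-object category of Example 3.5 (`C = 𝔽 × 𝔽` over `D = 𝔽`, `Base = pr₁`,
  `deg_Fr = deg ∘ pr₂`, but `Φ := 0`), for which print's switching self-equivalence `Ex35.swapEquiv` maps the
  base-isomorphism `((0,1),(1,1))` (`Ex35.witness`) to `((1,1),(0,1))`, whose base component `(1,1) ∈ 𝔽` is not
  invertible (`exists_not_hypB`, `not_forall_hypB`). Instance forms in the tree (what consumers bind): `DegreeModel.hypB`,
  `ModelFrobenioid.hypB_walkingArrow`, `FrdI.hypB_symm`, `FrdI.hypB_istr`.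
* `PreFrobenioidData.OneUniqueSquare T L R B` (F-0894) is the SHAPE "`1`-unique `1`-commutative square" (§0 p. 15),
  vocabulary of the conclusions of Thm. 3.4 (i), (iii)–(v), Prop. 3.11 (iii). Its closure fails already because `B`
  ranges over all functors; the tree moreover holds a mathematically meaningful failure — NO functor makes the
  perfection square of Thm. 3.4 (iii) AS TYPED bare-`1`-unique for the degree model (`DegreeModel.not_oneUniqueSquare_toPf`,
  abc-iut-L1-d4) — which is the witness used for `not_forall_oneUniqueSquare`. Instance forms in the tree:
  `PreFrobenioidData.oneUniqueSquare_untrMap`, `PreFrobenioidData.oneUniqueSquare_toBaseDeg_of_oneCommutes`,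
  `PreFrobenioid.Birat.oneUniqueSquare_mapOfEquiv`, `PreFrobenioid.Perfection.oneUniqueSquare_map_of_isOfPerfectType`.
* `PreFrobenioidData.PreservesDegFr S₁ S₂ Ψ` (F-0895) is the CONCLUSION "`Ψ` preserves Frobenius degrees" of
  Thm. 3.4 (iii)/(iv). Print's own Example 3.5 refutes its closure: the switching self-equivalence of `C = 𝔽 × 𝔽`
  exchanges the base coordinate and the `(Div, deg_Fr)` coordinate, so it sends the linear arrow `((0,2),(0,1))` to an
  arrow of Frobenius degree `2` (`Ex35.not_preservesDegFr_swapEquiv`, `not_forall_preservesDegFr`). Instance forms in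
  the tree: `FrdI.Thm34Sub.l09_preservesDegFr_of_FSMHyp`, `FrdI.preservesDegFr_of_thm34ii_thm34iii`, `FrdI.degFr_map`.
* `PreFrobenioidData.Prop311ii S₁ S₂ Ψ` (F-0897) is Prop. 3.11 (ii) typed as a conclusion predicate over the bare
  interface; the paper asserts it for FROBENIOIDS, and in that form it is PROVED in the tree
  (`FrdI.prop311ii_ofFunctor (hF₁ : IsFrobenioid F₁) (hF₂ : IsFrobenioid F₂) (Ψ) :
  Prop311ii (ofFunctor Φ₁ F₁) (ofFunctor Φ₂ F₂) Ψ`, abc-iut-L1-t13; closed twin `FrdI.Prop311ii_iii_holds`, F-0705).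
  Over the bare interface the closure is false: on the walking arrow `C = D = (0 ⟶ 1)` (`Fin 2`, of FSMFF-type by
  `WalkingArrow.isOfFSMFFType`) with `Base = 𝟭`, `Φ = 0`, the two degree assignments "`deg_Fr ≡ 1`" and
  "`deg_Fr(0 ⟶ 1) = 2`" both satisfy the setting of Prop. 3.11 (isotropic, unit-trivial, group-like type), and
  `Ψ = 𝟭` does not carry the linear arrow `0 ⟶ 1` of the first to a linear arrow of the second
  (`exists_not_prop311ii`, `not_forall_prop311ii`) — such operations are not those of a Frobenioid (Def. 1.3 (i)(c)
  would require arrows of every Frobenius degree), which is exactly why `IsFrobenioid` is the faithful hypothesis.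

So each row is admissible ONLY in its instance form (FACT-LIST class «universal-closure REFUTED; instance form
PROVED / model-witnessed»). The closures are refuted at universe `0` (small categories in `Type`). Classical
bookkeeping about [FrdI] §3; nothing here bears on the disputed [IUTchIII] Cor. 3.12 or takes a side; a refuted
closure is never a fact, and no statement of the paper is asserted false.
-/

namespace Literature.AlgebraicGeometry.Frobenioids

open CategoryTheory

/-! ## F-0895 `PreservesDegFr`: Example 3.5's switching equivalence changes Frobenius degrees -/

namespace Ex35

/-- **Example 3.5, degrees**: the switching self-equivalence `(x, y) ↦ (y, x)` of the one-object category
`C = 𝔽 × 𝔽` (FrdI pp. 69–70) does NOT preserve Frobenius degrees for the operations `deg_Fr = deg ∘ pr₂`: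
the arrow `((0,2),(0,1))` is linear, its image `((0,1),(0,2))` has Frobenius degree `2`.
[cite: MochizukiFrdI2008, Ex. 3.5 p.70] -/
theorem not_preservesDegFr_swapEquiv : ¬ PreFrobenioidData.PreservesDegFr data data swapEquiv := by
  intro h
  have h21 := h (show SingleObj.star (StandardFrobenioid × StandardFrobenioid) ⟶ SingleObj.star _ from
    ((StandardFrobenioid.degSection 2, 1) : StandardFrobenioid × StandardFrobenioid))
  have h2 : ((data.degFr (swapEquiv.functor.map
      (show SingleObj.star (StandardFrobenioid × StandardFrobenioid) ⟶ SingleObj.star _ from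
        ((StandardFrobenioid.degSection 2, 1) : StandardFrobenioid × StandardFrobenioid))) : ℕ+) : ℕ) = 2 := rfl
  have h1 : ((data.degFr (show SingleObj.star (StandardFrobenioid × StandardFrobenioid) ⟶ SingleObj.star _ from
      ((StandardFrobenioid.degSection 2, 1) : StandardFrobenioid × StandardFrobenioid)) : ℕ+) : ℕ) = 1 := rfl
  rw [h21] at h2
  omega

end Ex35

/-- **FACT-LIST F-0895, universal closure REFUTED** (witness: Example 3.5's `C = 𝔽 × 𝔽 → D = 𝔽` with its
switching self-equivalence, `Ex35.not_preservesDegFr_swapEquiv`). The instance forms for Frobenioids are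
`FrdI.Thm34Sub.l09_preservesDegFr_of_FSMHyp` / `FrdI.preservesDegFr_of_thm34ii_thm34iii` (Thm. 3.4 (iii)/(iv)).
[cite: MochizukiFrdI2008, Thm. 3.4 (iv) p.63] -/
theorem not_forall_preservesDegFr :
    ¬ ∀ (C₁ : Type) [SmallCategory C₁] (D₁ : Type) [SmallCategory D₁] (C₂ : Type) [SmallCategory C₂]
        (D₂ : Type) [SmallCategory D₂] (S₁ : PreFrobenioidData.{0} C₁ D₁) (S₂ : PreFrobenioidData.{0} C₂ D₂)
        (Ψ : C₁ ≌ C₂), PreFrobenioidData.PreservesDegFr S₁ S₂ Ψ :=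
  fun h => Ex35.not_preservesDegFr_swapEquiv (h _ _ _ _ Ex35.data Ex35.data Ex35.swapEquiv)

/-! ## F-0893 `HypB`: hypothesis (b) of Thm. 3.4 (iii) is not automatic -/

/-- **Hypothesis (b) of Thm. 3.4 (iii) fails for some pre-Frobenioid operations of group-like type**: on the
one-object category `C = 𝔽 × 𝔽 → D = 𝔽` of Example 3.5 take the GROUP-LIKE operations (`Base = pr₁`,
`deg_Fr = deg ∘ pr₂`, `Φ := 0`); then print's switching self-equivalence maps the base-isomorphism
`((0,1),(1,1))` to `((1,1),(0,1))`, whose base component `(1,1) ∈ 𝔽` is not a unit — so "`Ψ` preserves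
base-isomorphisms" fails (cf. Examples 3.6–3.9, pp. 70–72, for print's own Frobenioids of group-like type
violating (b)). [cite: MochizukiFrdI2008, Thm. 3.4 (iii) p.62] -/
theorem exists_not_hypB :
    ∃ S : PreFrobenioidData.{0} Ex35.C Ex35.D, S.IsOfGroupLikeType ∧ ¬ S.HypB S Ex35.swapEquiv := by
  -- the group-like reading of Example 3.5's operations: same base and degrees, trivial divisor monoid
  let S : PreFrobenioidData.{0} Ex35.C Ex35.D :=
    { base := Ex35.data.base
      Mon := fun _ => PUnit
      pull := fun _ => MonoidHom.id PUnit
      pull_id := fun _ _ => rfl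
      pull_comp := fun _ _ _ => rfl
      div := fun _ => PUnit.unit
      degFr := fun φ => Ex35.data.degFr φ
      div_id := fun _ => rfl
      div_comp := fun _ _ => rfl
      degFr_id := Ex35.data.degFr_id
      degFr_comp := Ex35.data.degFr_comp }
  have hgl : S.IsOfGroupLikeType := ⟨fun _ _ => rfl⟩
  refine ⟨S, hgl, fun h => ?_⟩
  obtain ⟨hfun, -⟩ := h hgl hgl
  -- `Ex35.witness = ((0,1),(1,1))` is a base-isomorphism (its base component is `1 ∈ 𝔽`) …
  have hw : S.IsBaseIso Ex35.witness := Ex35.isPreStep_witness.2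
  -- … but the base component of its image `((1,1),(0,1))` is the generator `(1,1)`, not invertible in `𝔽`
  have himg : S.IsBaseIso (Ex35.swap.map Ex35.witness) := hfun Ex35.witness hw
  have h1 := @Ex35.eq_one_of_isIso _ _ _ himg
  have h2 : (show StandardFrobenioid from Ex35.data.base.map (Ex35.swap.map Ex35.witness)) =
      StandardFrobenioid.gen := rfl
  rw [h2] at h1
  have h3 := congrArg (fun x : StandardFrobenioid => Multiplicative.toAdd x.div) h1
  simp only [StandardFrobenioid.gen, toAdd_ofAdd, ElemFrobenioidMonoid.one_div, toAdd_one] at h3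
  exact Nat.one_ne_zero h3

/-- **FACT-LIST F-0893, universal closure REFUTED** (witness: `exists_not_hypB`). `HypB` is hypothesis (b) of
Thm. 3.4 (iii)–(v) / Cor. 4.11–4.12 and is consumed only as a binder; instance forms in the tree:
`DegreeModel.hypB`, `ModelFrobenioid.hypB_walkingArrow`, `FrdI.hypB_symm`, `FrdI.hypB_istr`.
[cite: MochizukiFrdI2008, Thm. 3.4 (iii) p.62] -/
theorem not_forall_hypB :
    ¬ ∀ (C₁ : Type) [SmallCategory C₁] (D₁ : Type) [SmallCategory D₁] (C₂ : Type) [SmallCategory C₂]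
        (D₂ : Type) [SmallCategory D₂] (S₁ : PreFrobenioidData.{0} C₁ D₁) (S₂ : PreFrobenioidData.{0} C₂ D₂)
        (Ψ : C₁ ≌ C₂), PreFrobenioidData.HypB S₁ S₂ Ψ := by
  intro h
  obtain ⟨S, -, hS⟩ := exists_not_hypB
  exact hS (h _ _ _ _ S S Ex35.swapEquiv)

/-! ## F-0894 `OneUniqueSquare`: the shape is not satisfied by every square -/

/-- **FACT-LIST F-0894, universal closure REFUTED** (witness: the perfection square of Thm. 3.4 (iii) AS TYPED
for the degree model and `Ψ = 𝟭`, which NO functor `C^pf ⥤ C^pf` makes bare-`1`-unique —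
`DegreeModel.not_oneUniqueSquare_toPf`, abc-iut-L1-d4). `OneUniqueSquare` is the vocabulary "`1`-unique
`1`-commutative square" (§0 p. 15); instance forms in the tree: `PreFrobenioidData.oneUniqueSquare_untrMap`,
`PreFrobenioidData.oneUniqueSquare_toBaseDeg_of_oneCommutes`, `PreFrobenioid.Birat.oneUniqueSquare_mapOfEquiv`,
`PreFrobenioid.Perfection.oneUniqueSquare_map_of_isOfPerfectType`. [cite: MochizukiFrdI2008, Thm. 3.4 (i) p.62] -/
theorem not_forall_oneUniqueSquare :
    ¬ ∀ (X₁ : Type) [SmallCategory X₁] (X₂ : Type) [SmallCategory X₂] (Y₁ : Type) [SmallCategory Y₁]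
        (Y₂ : Type) [SmallCategory Y₂] (T : X₁ ⥤ X₂) (L : X₁ ⥤ Y₁) (R : X₂ ⥤ Y₂) (B : Y₁ ⥤ Y₂),
        PreFrobenioidData.OneUniqueSquare T L R B :=
  fun h => DegreeModel.not_oneUniqueSquare_toPf (𝟭 _) (h _ _ _ _ (𝟭 DegreeModel.C) _ _ (𝟭 _))

/-! ## F-0897 `Prop311ii`: over the bare interface, linearity need not be preserved -/

/-- **Prop. 3.11 (ii) as a predicate over the bare operations interface has a refutable closure**: on the walking
arrow `C = D = (0 ⟶ 1)` with `Base = 𝟭` and `Φ = 0`, the operations with `deg_Fr ≡ 1`, resp. with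
`deg_Fr(0 ⟶ 1) = 2`, both satisfy the setting of Prop. 3.11 (`D` of FSMFF-type — `WalkingArrow.isOfFSMFFType` —,
`C` of isotropic, unit-trivial and group-like type), yet `Ψ = 𝟭` maps the linear arrow `0 ⟶ 1` of the first to a
non-linear arrow of the second. (Such operations are not those of a Frobenioid; for Frobenioids Prop. 3.11 (ii)
is the tree's theorem `FrdI.prop311ii_ofFunctor`.) [cite: MochizukiFrdI2008, Prop. 3.11 (ii) p.73] -/
theorem exists_not_prop311ii :
    ∃ S₁ S₂ : PreFrobenioidData.{0} (Fin 2) (Fin 2),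
      PreFrobenioidData.Prop311Setting S₁ ∧ PreFrobenioidData.Prop311Setting S₂ ∧
        ¬ S₁.Prop311ii S₂ (CategoryTheory.Equivalence.refl (C := Fin 2)) := by
  -- the operations on the walking arrow with `deg_Fr(0 ⟶ 1) := d`, `Base := 𝟭`, `Φ := 0`
  let T : ℕ+ → PreFrobenioidData.{0} (Fin 2) (Fin 2) := fun d =>
    { base := 𝟭 (Fin 2)
      Mon := fun _ => PUnit
      pull := fun _ => MonoidHom.id PUnit
      pull_id := fun _ _ => rfl
      pull_comp := fun _ _ _ => rfl
      div := fun _ => PUnit.unit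
      degFr := fun {a b} _ => if a = b then 1 else d
      div_id := fun _ => rfl
      div_comp := fun _ _ => rfl
      degFr_id := fun a => if_pos rfl
      degFr_comp := fun {a b c} ψ φ => by
        have hab : a ≤ b := leOfHom ψ
        have hbc : b ≤ c := leOfHom φ
        fin_cases a <;> fin_cases b <;> fin_cases c <;> simp at hab hbc ⊢ }
  -- both satisfy the setting of Prop. 3.11: with `Base = 𝟭` a pre-step is an isomorphism, and `Fin 2` is thin
  have hT : ∀ d, PreFrobenioidData.Prop311Setting (T d) := fun d =>
    { zero := fun _ _ => rfl
      fsmff := WalkingArrow.isOfFSMFFType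
      isotropic := ⟨fun A B φ hφ => hφ.1.2⟩
      unitTrivial := ⟨fun A => (Subgroup.eq_bot_iff_forall _).2 fun α _ => Iso.ext (Subsingleton.elim _ _)⟩
      groupLike := ⟨fun _ _ => rfl⟩ }
  refine ⟨T 1, T 2, hT 1, hT 2, fun h => ?_⟩
  obtain ⟨-, -, hlin, -⟩ := h (hT 1) (hT 2)
  have h01 : (T 1).IsLinear (homOfLE (Fin.zero_le (1 : Fin 2)) : (0 : Fin 2) ⟶ 1) := by
    show (if (0 : Fin 2) = 1 then (1 : ℕ+) else 1) = 1
    simp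
  have h2 : (if (0 : Fin 2) = 1 then (1 : ℕ+) else 2) = 1 := hlin _ h01
  simp at h2

/-- **FACT-LIST F-0897, universal closure REFUTED** (witness: `exists_not_prop311ii`, the walking arrow). The
printed Prop. 3.11 (ii) — for Frobenioids — is the tree's `FrdI.prop311ii_ofFunctor` (with (iii):
`FrdI.Prop311ii_iii_holds`, F-0705). [cite: MochizukiFrdI2008, Prop. 3.11 (ii) p.73] -/
theorem not_forall_prop311ii :
    ¬ ∀ (C₁ : Type) [SmallCategory C₁] (D₁ : Type) [SmallCategory D₁] (C₂ : Type) [SmallCategory C₂]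
        (D₂ : Type) [SmallCategory D₂] (S₁ : PreFrobenioidData.{0} C₁ D₁) (S₂ : PreFrobenioidData.{0} C₂ D₂)
        (Ψ : C₁ ≌ C₂), PreFrobenioidData.Prop311ii S₁ S₂ Ψ := by
  intro h
  obtain ⟨S₁, S₂, -, -, hS⟩ := exists_not_prop311ii
  exact hS (h _ _ _ _ S₁ S₂ _)

end Literature.AlgebraicGeometry.Frobenioids
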